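import Summits.CriticalPhenomena.CardyFormulaZ2.Theorems.CardyBoundaryCoulombGasRectilinearCardyRowDefs
import Literature.Probability.LatticeModels.FlatBoundaryFrameWindow
import HarnessLib

/-!
# Stub `stub_kernelWindowLaw` of line `excursion-kernel-covariance`, part 1: the straight side of an
# admissible window (crux `RectilinearCardy`, stmt-CriticalPhenomena-5660, route `CardyBoundaryCoulombGas`)

Continuum geometry of an ADMISSIBLE parameter range `[σ, σ']` of a conformal rectangle
`R = (Ω; a, b, c, d)` (`AdmissibleRange`: strictly inside `(mark 1, mark 3)`, uniformly flat with
radius `r`), in the language of the tree's oriented frames (`Orient`, `Orient.nrmC`, `Orient.tngC`,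
`Orient.e`, `Orient.ν` of `LatticeOrientFrame.lean`):

* `kwl_orient_unique` — two closed half-planes through a point that agree near it have the same
  orientation;
* `kwl_const_of_locally_const` — a function locally constant along `[a, b]` is constant there
  (`isPreconnected_Icc`, discrete topology on the target);
* `kwl_exists_windowFrame` — **the window is one straight side**: there are ONE orientation `o` and ONE
  height `h` such that every window point `∂Ω(t)`, `t ∈ [σ, σ']`, has normal coordinate `h` and,
  inside `B(∂Ω(t), r)`, `Ω̄ = {nrmC ≥ h}` and `Ω = {nrmC > h}` (the tree's `exists_orient_of_flat` at
  every window point; the orientation and the height are locally constant along the window);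
* `kwl_mem_frontier_iff_nrmC` — near the window the frontier is the line `{nrmC = h}`;
* `kwl_strictMonoOn_or_strictAntiOn_tng` — the tangential coordinate `T(t) = tngC(∂Ω(t))` is
  continuous and injective on `[σ, σ']`, hence strictly monotone;
* `kwl_exists_param_sep` — frontier points close to an inner window `∂Ω([s, s'])`,
  `σ < s ≤ s' < σ'`, have parameters in `(σ, σ')` (compactness and injectivity of the loop);
* `kwl_exists_admissible_enlarge` — an admissible range containing `[s, s']` can be enlarged to one
  containing it strictly inside.

All [folklore] plane topology.
-/

noncomputable section

open Set Filter Topology Metric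
open Literature.Probability.RandomPlanarGeometry
open Literature.Probability.LatticeModels (Orient exists_orient_of_flat)

namespace Summit.CriticalPhenomena.CardyFormulaZ2.Cruxes.RectilinearCardy.ExcursionKernelCovariance

/-! ### Frame algebra -/

/-- `nrmC` is real-homogeneous. [folklore] -/
theorem kwl_nrmC_real_mul (o : Orient) (c : ℝ) (p : ℂ) :
    Orient.nrmC o ((c : ℂ) * p) = c * Orient.nrmC o p := by
  cases o <;> simp [Orient.nrmC]

/-- `tngC` is real-homogeneous. [folklore] -/
theorem kwl_tngC_real_mul (o : Orient) (c : ℝ) (p : ℂ) :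
    Orient.tngC o ((c : ℂ) * p) = c * Orient.tngC o p := by
  cases o <;> simp [Orient.tngC]

/-- The inward normal has normal coordinate `1`. [folklore] -/
theorem kwl_nrmC_ν (o : Orient) : Orient.nrmC o (Orient.ν o) = 1 := by
  cases o <;> simp [Orient.nrmC, Orient.ν]

/-- The inward normal of a DIFFERENT orientation has non-positive normal coordinate. [folklore] -/
theorem kwl_nrmC_ν_nonpos {o o' : Orient} (h : o ≠ o') : Orient.nrmC o (Orient.ν o') ≤ 0 := by
  cases o <;> cases o' <;> simp_all [Orient.nrmC, Orient.ν]

/-- Pythagoras in the frame: `|p|² = tngC(p)² + nrmC(p)²`. [folklore] -/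
theorem kwl_norm_sq (o : Orient) (p : ℂ) : ‖p‖ ^ 2 = Orient.tngC o p ^ 2 + Orient.nrmC o p ^ 2 := by
  rw [Complex.sq_norm, Complex.normSq_apply]
  cases o <;> simp [Orient.tngC, Orient.nrmC] <;> ring

/-- Pythagoras for distances in the frame. [folklore] -/
theorem kwl_dist_sq (o : Orient) (p q : ℂ) :
    dist p q ^ 2 = (Orient.tngC o p - Orient.tngC o q) ^ 2 + (Orient.nrmC o p - Orient.nrmC o q) ^ 2 := by
  rw [dist_eq_norm, kwl_norm_sq o, Orient.tngC_sub, Orient.nrmC_sub]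

/-- The normal distance is at most the distance. [folklore] -/
theorem kwl_abs_nrmC_sub_le_dist (o : Orient) (p q : ℂ) :
    |Orient.nrmC o p - Orient.nrmC o q| ≤ dist p q := by
  rw [dist_eq_norm]; exact Orient.abs_nrmC_sub_le_norm o p q

/-- A point minus its foot on the line `{nrmC = h}` is `(nrmC p - h) ν`. [folklore] -/
theorem kwl_sub_foot (o : Orient) (p : ℂ) (h : ℝ) :
    p - (((Orient.tngC o p : ℝ) : ℂ) * Orient.e o + ((h : ℝ) : ℂ) * Orient.ν o) =
      (((Orient.nrmC o p - h : ℝ)) : ℂ) * Orient.ν o := by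
  have := Orient.tngC_mul_e_add_nrmC_mul_ν o p
  nth_rewrite 1 [← this]
  push_cast
  ring

/-- Distance of a point to its foot on the line `{nrmC = h}`. [folklore] -/
theorem kwl_dist_foot (o : Orient) (p : ℂ) (h : ℝ) :
    dist p (((Orient.tngC o p : ℝ) : ℂ) * Orient.e o + ((h : ℝ) : ℂ) * Orient.ν o) =
      |Orient.nrmC o p - h| := by
  rw [dist_eq_norm, kwl_sub_foot, norm_mul, Complex.norm_real, Orient.norm_ν, mul_one,
    Real.norm_eq_abs]

/-- A point with normal coordinate `h` is the line point with its tangential coordinate. [folklore] -/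
theorem kwl_eq_combo_of_nrmC {o : Orient} {h : ℝ} {p : ℂ} (hp : Orient.nrmC o p = h) :
    p = ((Orient.tngC o p : ℝ) : ℂ) * Orient.e o + ((h : ℝ) : ℂ) * Orient.ν o := by
  rw [← hp]; exact (Orient.tngC_mul_e_add_nrmC_mul_ν o p).symm

/-- Distance between two points of the line `{nrmC = h}`. [folklore] -/
theorem kwl_dist_combo (o : Orient) (x y h : ℝ) :
    dist (((x : ℝ) : ℂ) * Orient.e o + ((h : ℝ) : ℂ) * Orient.ν o)
      (((y : ℝ) : ℂ) * Orient.e o + ((h : ℝ) : ℂ) * Orient.ν o) = |x - y| := by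
  rw [dist_eq_norm, show ((x : ℝ) : ℂ) * Orient.e o + ((h : ℝ) : ℂ) * Orient.ν o -
      (((y : ℝ) : ℂ) * Orient.e o + ((h : ℝ) : ℂ) * Orient.ν o) = ((x - y : ℝ) : ℂ) * Orient.e o by
      push_cast; ring, norm_mul, Complex.norm_real, Orient.norm_e, mul_one, Real.norm_eq_abs]

/-- `tngC` is continuous. [folklore] -/
theorem kwl_continuous_tngC (o : Orient) : Continuous (Orient.tngC o) := by
  have : Orient.tngC o = fun p => Orient.tngC o p := rfl
  rw [this]
  cases o
  · exact Complex.continuous_re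
  · exact Complex.continuous_re
  · exact Complex.continuous_im
  · exact Complex.continuous_im

/-- `nrmC` is continuous. [folklore] -/
theorem kwl_continuous_nrmC (o : Orient) : Continuous (Orient.nrmC o) := by
  have : Orient.nrmC o = fun p => Orient.nrmC o p := rfl
  rw [this]
  cases o
  · exact Complex.continuous_im
  · exact Complex.continuous_im.neg
  · exact Complex.continuous_re
  · exact Complex.continuous_re.neg

/-! ### Uniqueness of the orientation and a connectedness lemma -/

/-- **Two closed half-planes through `y` that agree in a ball around `y` have the same
orientation**: test the point `y - (ρ/2) ν(o')`. [folklore] -/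
theorem kwl_orient_unique {o o' : Orient} {y : ℂ} {ρ : ℝ} (hρ : 0 < ρ)
    (h : ∀ z, dist z y < ρ →
      (Orient.nrmC o y ≤ Orient.nrmC o z ↔ Orient.nrmC o' y ≤ Orient.nrmC o' z)) : o = o' := by
  by_contra hne
  set z : ℂ := y - (((ρ / 2 : ℝ)) : ℂ) * Orient.ν o' with hz
  have hd : dist z y < ρ := by
    rw [hz, dist_eq_norm, sub_sub_cancel_left, norm_neg, norm_mul, Complex.norm_real, Orient.norm_ν,
      mul_one, Real.norm_eq_abs, abs_of_pos (by positivity)]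
    linarith
  have h1 := h z hd
  rw [hz, Orient.nrmC_sub, Orient.nrmC_sub, kwl_nrmC_real_mul, kwl_nrmC_real_mul, kwl_nrmC_ν] at h1
  have h2 : Orient.nrmC o (Orient.ν o') ≤ 0 := kwl_nrmC_ν_nonpos hne
  have h3 : Orient.nrmC o y ≤ Orient.nrmC o y - ρ / 2 * Orient.nrmC o (Orient.ν o') := by nlinarith
  have h4 := h1.1 h3
  linarith

/-- **A function that is locally constant along `[a, b]` is constant there** (`[a, b]` is
preconnected; discrete topology on the target). [folklore] -/
theorem kwl_const_of_locally_const {β : Type*} (Ψ : ℝ → β) {a b : ℝ}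
    (hloc : ∀ t ∈ Icc a b, ∃ θ : ℝ, 0 < θ ∧ ∀ t' ∈ Icc a b, dist t' t < θ → Ψ t' = Ψ t) :
    ∀ t ∈ Icc a b, Ψ t = Ψ a := by
  intro t ht
  letI : TopologicalSpace β := ⊥
  haveI : DiscreteTopology β := ⟨rfl⟩
  have hcont : ContinuousOn Ψ (Icc a b) := by
    intro x hx
    rw [ContinuousWithinAt, nhds_discrete, tendsto_pure, eventually_nhdsWithin_iff,
      Metric.eventually_nhds_iff]
    obtain ⟨θ, hθ, hθ'⟩ := hloc x hx
    exact ⟨θ, hθ, fun y hy hyI => hθ' y hyI hy⟩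
  exact isPreconnected_Icc.constant hcont ht (left_mem_Icc.2 (ht.1.trans ht.2))

/-! ### The window is one straight side -/

/-- **The straight side of an admissible window.** For an admissible range `[σ, σ']` there are an
orientation `o`, a height `h` and a radius `r > 0` such that for every `t ∈ [σ, σ']`:
`nrmC o (∂Ω(t)) = h`, and inside `B(∂Ω(t), r)` membership in `Ω̄` is `h ≤ nrmC o z` and membership in
`Ω` is `h < nrmC o z`. (At each window point the tree's `exists_orient_of_flat` gives such a
description with the point's own orientation and height; both are locally constant along the
window — a nearby window point is a frontier point of the same ball, so it has the same height, and
the two half-plane descriptions agree near it, so `kwl_orient_unique` — hence constant.) [folklore] -/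
theorem kwl_exists_windowFrame (R : ConformalRectangle) {σ σ' : ℝ} (hadm : AdmissibleRange R σ σ') :
    ∃ (o : Orient) (h r : ℝ), 0 < r ∧ ∀ t ∈ Icc σ σ',
      Orient.nrmC o (R.boundary t) = h ∧
      (∀ z, dist z (R.boundary t) < r → (z ∈ closure R.carrier ↔ h ≤ Orient.nrmC o z)) ∧
      (∀ z, dist z (R.boundary t) < r → (z ∈ R.carrier ↔ h < Orient.nrmC o z)) := by
  classical
  obtain ⟨-, -, -, r, hr, hflat⟩ := hadm
  have hex : ∀ t ∈ Icc σ σ', ∃ o : Orient,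
      (∀ z, dist z (R.boundary t) < r →
        (z ∈ closure R.carrier ↔ Orient.nrmC o (R.boundary t) ≤ Orient.nrmC o z)) ∧
      (∀ z, dist z (R.boundary t) < r →
        (z ∈ R.carrier ↔ Orient.nrmC o (R.boundary t) < Orient.nrmC o z)) :=
    fun t ht => exists_orient_of_flat R.toJordanDomain (R.boundary_mem_frontier t) hr (hflat t ht)
  set O : ℝ → Orient := fun t => if ht : t ∈ Icc σ σ' then (hex t ht).choose else Orient.up with hO
  have hOspec : ∀ t (ht : t ∈ Icc σ σ'),
      (∀ z, dist z (R.boundary t) < r →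
        (z ∈ closure R.carrier ↔ Orient.nrmC (O t) (R.boundary t) ≤ Orient.nrmC (O t) z)) ∧
      (∀ z, dist z (R.boundary t) < r →
        (z ∈ R.carrier ↔ Orient.nrmC (O t) (R.boundary t) < Orient.nrmC (O t) z)) := by
    intro t ht
    have hOt : O t = (hex t ht).choose := by rw [hO]; simp only [dif_pos ht]
    rw [hOt]
    exact (hex t ht).choose_spec
  -- a nearby window point has the same height and the same orientation
  have hnear : ∀ t ∈ Icc σ σ', ∀ t' ∈ Icc σ σ', dist (R.boundary t') (R.boundary t) < r / 2 →
      O t' = O t ∧ Orient.nrmC (O t) (R.boundary t') = Orient.nrmC (O t) (R.boundary t) := by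
    intro t ht t' ht' hd
    obtain ⟨hs, hs'⟩ := hOspec t ht
    obtain ⟨hts, -⟩ := hOspec t' ht'
    have hfr := R.boundary_mem_frontier t'
    rw [R.isOpen.frontier_eq] at hfr
    have heq : Orient.nrmC (O t) (R.boundary t') = Orient.nrmC (O t) (R.boundary t) := by
      have h1 := (hs _ (by linarith)).1 hfr.1
      have h2 : ¬ Orient.nrmC (O t) (R.boundary t) < Orient.nrmC (O t) (R.boundary t') :=
        fun hlt => hfr.2 ((hs' _ (by linarith)).2 hlt)
      push Not at h2
      exact le_antisymm h2 h1
    refine ⟨(kwl_orient_unique (y := R.boundary t') (half_pos hr) fun z hz => ?_).symm, heq⟩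
    have hz1 : dist z (R.boundary t) < r := by
      have := dist_triangle z (R.boundary t') (R.boundary t); linarith
    rw [heq, ← hs z hz1, hts z (by linarith)]
  set Ψ : ℝ → Orient × ℝ := fun t => (O t, Orient.nrmC (O t) (R.boundary t)) with hΨ
  have hloc : ∀ t ∈ Icc σ σ', ∃ θ : ℝ, 0 < θ ∧ ∀ t' ∈ Icc σ σ', dist t' t < θ → Ψ t' = Ψ t := by
    intro t ht
    obtain ⟨θ, hθ, hθr⟩ := Metric.continuous_iff.1 R.continuous_boundary t (r / 2) (half_pos hr)
    refine ⟨θ, hθ, fun t' ht' hd => ?_⟩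
    obtain ⟨hoo, hh⟩ := hnear t ht t' ht' (hθr t' hd)
    simp only [hΨ, hoo, hh]
  have hconst := kwl_const_of_locally_const Ψ hloc
  refine ⟨O σ, Orient.nrmC (O σ) (R.boundary σ), r, hr, fun t ht => ?_⟩
  have hc := hconst t ht
  simp only [hΨ, Prod.mk.injEq] at hc
  obtain ⟨ho, hh⟩ := hc
  obtain ⟨hs, hs'⟩ := hOspec t ht
  rw [ho] at hs hs' hh
  exact ⟨hh, fun z hz => by rw [hs z hz, hh], fun z hz => by rw [hs' z hz, hh]⟩

/-- **Near the window the frontier is the line `{nrmC = h}`.** [folklore] -/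
theorem kwl_mem_frontier_iff_nrmC (R : ConformalRectangle) {o : Orient} {h r : ℝ} {x : ℂ}
    (hcl : ∀ z, dist z x < r → (z ∈ closure R.carrier ↔ h ≤ Orient.nrmC o z))
    (hop : ∀ z, dist z x < r → (z ∈ R.carrier ↔ h < Orient.nrmC o z)) {z : ℂ} (hz : dist z x < r) :
    z ∈ frontier R.carrier ↔ Orient.nrmC o z = h := by
  rw [R.isOpen.frontier_eq, Set.mem_sdiff, hcl z hz, hop z hz, not_lt]
  exact ⟨fun h' => le_antisymm h'.2 h'.1, fun h' => ⟨h'.ge, h'.le⟩⟩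

/-- Window parameters are loop parameters in `[0, 1)`. [folklore] -/
theorem kwl_mem_Ico_of_window (R : ConformalRectangle) {σ σ' t : ℝ} (h1 : R.mark 1 < σ)
    (h3 : σ' < R.mark 3) (ht : t ∈ Icc σ σ') : t ∈ Ico (0 : ℝ) 1 := by
  have h0 := (R.mark_mem 0).1
  have h01 : R.mark 0 < R.mark 1 := R.strictMono_mark (show (0 : Fin 4) < 1 by decide)
  have h31 := (R.mark_mem 3).2
  exact ⟨by linarith [ht.1], by linarith [ht.2]⟩

/-- **The tangential coordinate is injective along the window**: `T(t) = tngC o (∂Ω(t))` determines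
`∂Ω(t) = T(t) e + h ν`, and the loop is injective on `[σ, σ'] ⊆ [0, 1)`. [folklore] -/
theorem kwl_injOn_tng (R : ConformalRectangle) {o : Orient} {h σ σ' : ℝ} (h1 : R.mark 1 < σ)
    (h3 : σ' < R.mark 3) (hh : ∀ t ∈ Icc σ σ', Orient.nrmC o (R.boundary t) = h) :
    InjOn (fun t => Orient.tngC o (R.boundary t)) (Icc σ σ') := by
  intro t ht t' ht' heq
  simp only at heq
  have hb : R.boundary t = R.boundary t' := by
    rw [kwl_eq_combo_of_nrmC (hh t ht), kwl_eq_combo_of_nrmC (hh t' ht'), heq]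
  exact R.injOn_boundary (kwl_mem_Ico_of_window R h1 h3 ht) (kwl_mem_Ico_of_window R h1 h3 ht') hb

/-- The tangential coordinate along the loop is continuous. [folklore] -/
theorem kwl_continuous_tng (R : ConformalRectangle) (o : Orient) :
    Continuous fun t => Orient.tngC o (R.boundary t) :=
  (kwl_continuous_tngC o).comp R.continuous_boundary

/-- **The tangential coordinate is strictly monotone or strictly antitone along the window**
(continuous and injective on `[σ, σ']`). [folklore] -/
theorem kwl_strictMonoOn_or_strictAntiOn_tng (R : ConformalRectangle) {o : Orient} {h σ σ' : ℝ}
    (h1 : R.mark 1 < σ) (hσσ' : σ ≤ σ') (h3 : σ' < R.mark 3)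
    (hh : ∀ t ∈ Icc σ σ', Orient.nrmC o (R.boundary t) = h) :
    StrictMonoOn (fun t => Orient.tngC o (R.boundary t)) (Icc σ σ') ∨
      StrictAntiOn (fun t => Orient.tngC o (R.boundary t)) (Icc σ σ') :=
  (kwl_continuous_tng R o).continuousOn.strictMonoOn_of_injOn_Icc' hσσ' (kwl_injOn_tng R h1 h3 hh)

/-- **The window covers its chord**: every value between `T(s)` and `T(s')` is `T(u)` for some
`u ∈ [s, s']` (intermediate value theorem), and then `∂Ω(u)` is the corresponding line point.
[folklore] -/
theorem kwl_exists_param_of_mem_uIcc (R : ConformalRectangle) {o : Orient} {h s s' : ℝ}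
    (hss' : s ≤ s') (hh : ∀ t ∈ Icc s s', Orient.nrmC o (R.boundary t) = h) {x : ℝ}
    (hx : x ∈ uIcc (Orient.tngC o (R.boundary s)) (Orient.tngC o (R.boundary s'))) :
    ∃ u ∈ Icc s s', Orient.tngC o (R.boundary u) = x ∧
      R.boundary u = ((x : ℝ) : ℂ) * Orient.e o + ((h : ℝ) : ℂ) * Orient.ν o := by
  obtain ⟨u, hu, hux⟩ := intermediate_value_uIcc (a := s) (b := s')
    (kwl_continuous_tng R o).continuousOn hx
  rw [uIcc_of_le hss'] at hu
  refine ⟨u, hu, hux, ?_⟩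
  rw [← hux]
  exact kwl_eq_combo_of_nrmC (hh u hu)

/-! ### Parameters of frontier points near an inner window -/

/-- **Frontier points near an inner window have parameters in `(σ, σ')`.** If
`mark 1 < σ < s ≤ s' < σ' < mark 3`, there is `d₀ > 0` such that every frontier point within `d₀` of
some `∂Ω(τ)`, `τ ∈ [s, s']`, is `∂Ω(u)` with `u ∈ (σ, σ')`: the compact arc
`∂Ω([0, σ] ∪ [σ', 1])` misses the compact `∂Ω([s, s'])` (injectivity of the loop on `[0, 1)`), so it
stays at positive distance. [folklore] -/
theorem kwl_exists_param_sep (R : ConformalRectangle) {σ σ' s s' : ℝ} (h1 : R.mark 1 < σ)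
    (hσs : σ < s) (hss' : s ≤ s') (hs'σ' : s' < σ') (h3 : σ' < R.mark 3) :
    ∃ d₀ : ℝ, 0 < d₀ ∧ ∀ z ∈ frontier R.carrier, ∀ τ ∈ Icc s s', dist z (R.boundary τ) < d₀ →
      ∃ u ∈ Ioo σ σ', R.boundary u = z := by
  set K : Set ℂ := R.boundary '' (Icc 0 σ ∪ Icc σ' 1) with hK
  have hKc : IsCompact K := (isCompact_Icc.union isCompact_Icc).image R.continuous_boundary
  have h0 := (R.mark_mem 0).1
  have h01 : R.mark 0 < R.mark 1 := R.strictMono_mark (show (0 : Fin 4) < 1 by decide)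
  have h31 := (R.mark_mem 3).2
  have hKne : K.Nonempty := ⟨R.boundary 0, 0, Or.inl ⟨le_rfl, by linarith⟩, rfl⟩
  -- window points are off `K`
  have hoff : ∀ τ ∈ Icc s s', R.boundary τ ∉ K := by
    rintro τ hτ ⟨u, hu, huτ⟩
    have hτI : τ ∈ Ico (0 : ℝ) 1 := ⟨by linarith [hτ.1], by linarith [hτ.2]⟩
    rcases hu with hu | hu
    · have := R.injOn_boundary ⟨hu.1, by linarith [hu.2]⟩ hτI huτ
      linarith [hτ.1, hu.2]
    · rcases hu.2.lt_or_eq with hlt | heq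
      · have := R.injOn_boundary ⟨by linarith [hu.1], hlt⟩ hτI huτ
        linarith [hτ.2, hu.1]
      · rw [heq, show (1 : ℝ) = 0 + 1 by norm_num, R.periodic_boundary 0] at huτ
        have := R.injOn_boundary ⟨le_rfl, by norm_num⟩ hτI huτ
        linarith [hτ.1]
  -- the distance to `K` has a positive minimum on the window
  have hcont : ContinuousOn (fun τ => infDist (R.boundary τ) K) (Icc s s') :=
    ((continuous_infDist_pt K).comp R.continuous_boundary).continuousOn
  obtain ⟨τ₀, hτ₀, hmin⟩ := isCompact_Icc.exists_isMinOn (nonempty_Icc.2 hss') hcont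
  refine ⟨infDist (R.boundary τ₀) K, (hKc.isClosed.notMem_iff_infDist_pos hKne).1 (hoff τ₀ hτ₀),
    fun z hz τ hτ hd => ?_⟩
  have hzK : z ∉ K := by
    intro hzK
    have h1 : infDist (R.boundary τ) K ≤ dist (R.boundary τ) z := infDist_le_dist_of_mem hzK
    have h2 : infDist (R.boundary τ₀) K ≤ infDist (R.boundary τ) K := hmin hτ
    rw [dist_comm] at h1
    linarith
  rw [← R.range_boundary] at hz
  obtain ⟨v, rfl⟩ := hz
  obtain ⟨u, hu, hvu⟩ := R.periodic_boundary.exists_mem_Ico one_pos v 0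
  rw [zero_add] at hu
  refine ⟨u, ⟨?_, ?_⟩, hvu.symm⟩
  · by_contra hle
    exact hzK ⟨u, Or.inl ⟨hu.1, not_lt.1 hle⟩, hvu.symm⟩
  · by_contra hle
    exact hzK ⟨u, Or.inr ⟨not_lt.1 hle, hu.2.le⟩, hvu.symm⟩

/-! ### Enlarging an admissible range -/

/-- Flatness is monotone in the radius. [folklore] -/
theorem kwl_flatNear_mono (R : ConformalRectangle) {x : ℂ} {r r' : ℝ} (h : FlatNear R x r)
    (hr : r' ≤ r) : FlatNear R x r' := by
  rcases h with h | h
  · exact Or.inl fun z hz hd => h z hz (lt_of_lt_of_le hd hr)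
  · exact Or.inr fun z hz hd => h z hz (lt_of_lt_of_le hd hr)

/-- A frontier point within `r/2` of a point flat at radius `r` is flat at radius `r/2`. [folklore] -/
theorem kwl_flatNear_of_near (R : ConformalRectangle) {x x' : ℂ} {r : ℝ} (h : FlatNear R x r)
    (hx' : x' ∈ frontier R.carrier) (hd : dist x' x < r / 2) : FlatNear R x' (r / 2) := by
  have hr : 0 < r := by linarith [dist_nonneg (x := x') (y := x)]
  rcases h with h | h
  · refine Or.inl fun z hz hzd => ?_
    have hzx : dist z x < r := by have := dist_triangle z x' x; linarith
    rw [h z hz hzx, h x' hx' (by linarith)]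
  · refine Or.inr fun z hz hzd => ?_
    have hzx : dist z x < r := by have := dist_triangle z x' x; linarith
    rw [h z hz hzx, h x' hx' (by linarith)]

/-- **Enlarging an admissible range.** If `[σ, σ']` is admissible and `σ ≤ s ≤ s' ≤ σ'`, some
admissible `[σ₁, σ₁']` has `σ₁ < s` and `s' < σ₁'` (continuity of the loop at `σ`, `σ'` and
`kwl_flatNear_of_near`; the marks `1`, `3` stay strictly outside). [folklore] -/
theorem kwl_exists_admissible_enlarge (R : ConformalRectangle) {σ σ' s s' : ℝ}
    (hadm : AdmissibleRange R σ σ') (hs : σ ≤ s) (hss' : s ≤ s') (hs' : s' ≤ σ') :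
    ∃ σ₁ σ₁' : ℝ, AdmissibleRange R σ₁ σ₁' ∧ σ₁ < s ∧ s' < σ₁' := by
  obtain ⟨h1, hσσ', h3, r, hr, hflat⟩ := hadm
  obtain ⟨θ, hθ, hθr⟩ := Metric.continuous_iff.1 R.continuous_boundary σ (r / 2) (half_pos hr)
  obtain ⟨θ', hθ', hθr'⟩ := Metric.continuous_iff.1 R.continuous_boundary σ' (r / 2) (half_pos hr)
  set σ₁ : ℝ := max (σ - θ / 2) ((R.mark 1 + σ) / 2) with hσ₁
  set σ₁' : ℝ := min (σ' + θ' / 2) ((σ' + R.mark 3) / 2) with hσ₁'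
  have hσ₁σ : σ₁ < σ := max_lt (by linarith) (by linarith)
  have hσ'σ₁' : σ' < σ₁' := lt_min (by linarith) (by linarith)
  have h1' : R.mark 1 < σ₁ := lt_of_lt_of_le (by linarith) (le_max_right _ _)
  have h3' : σ₁' < R.mark 3 := lt_of_le_of_lt (min_le_right _ _) (by linarith)
  refine ⟨σ₁, σ₁', ⟨h1', by linarith, h3', r / 2, half_pos hr, fun t ht => ?_⟩,
    lt_of_lt_of_le hσ₁σ hs, lt_of_le_of_lt hs' hσ'σ₁'⟩
  rcases lt_or_ge t σ with htσ | htσ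
  · have hd : dist t σ < θ := by
      rw [Real.dist_eq, abs_of_neg (by linarith)]
      have := le_max_left (σ - θ / 2) ((R.mark 1 + σ) / 2)
      linarith [ht.1]
    exact kwl_flatNear_of_near R (hflat σ ⟨le_rfl, hσσ'⟩) (R.boundary_mem_frontier t) (hθr t hd)
  rcases le_or_gt t σ' with htσ' | htσ'
  · exact kwl_flatNear_mono R (hflat t ⟨htσ, htσ'⟩) (by linarith)
  · have hd : dist t σ' < θ' := by
      rw [Real.dist_eq, abs_of_pos (by linarith)]
      have := min_le_left (σ' + θ' / 2) ((σ' + R.mark 3) / 2)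
      linarith [ht.2]
    exact kwl_flatNear_of_near R (hflat σ' ⟨hσσ', le_rfl⟩) (R.boundary_mem_frontier t) (hθr' t hd)

end Summit.CriticalPhenomena.CardyFormulaZ2.Cruxes.RectilinearCardy.ExcursionKernelCovariance

end
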